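import Summits.QuantumFields.BalabanUV.T4Continuum.Support.NE4TransferResolvent

/-!
# NE4TransferResolventCurrency — the resolvent route in an ARBITRARY COUPLING CURRENCY φ (file 4 of the route; cell
# `pub-balaban`, BINDER-OWNERS row NE4, co-owner #3, lineage `b2b-balaban-t4-ne4-p3`, generation 1)

HONEST FRAMING.  Rung (B)+1 on a FIXED finite torus; NOT infinite volume, NOT a mass gap, NOT Clay.  NE4 is NOT PRINTED and NOT
PROVED; every analytic input below is a displayed binder over the abstract `StepTransferModel` of `Support/NE4TransferModel`
(file 1), discharged by nobody.  HONEST DEPENDENCY (verbatim): continuum YM on T⁴ ⇐ BetaPertH ∧ nine spine estimates (0/9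
proved); BetaPertH ⇐ (D1) ∧ (D4) ∧ CAP+tail; G-an2-4 gates asym, D1 and NE2/3/4.

WHY.  Files 1–2 state the coupling modulus `CouplingLipschitz ℓ′ ℓ` in the coupling `g` itself and conclude
`T4CouplingMatching.HistLipschitz` (g-currency).  Row NE9's activity-level coupling two-point bounds for Bałaban's (2.14)-form
activities are constants only in the currency `t = g⁻²` (`Support/NE9CouplingTwoPoint`, `NE9LastCouplingBridge` §5;
`T4CurrencyMatching` CURRENCY paragraph; the row owner's gen-33 t-faces), and for the ε₁ cut-off no g-uniform modulus is
available from print (G-b12g6-2; tree no-go `T4CouplingAnalyticity.exists_couplingAnalyticRel_not_ne9Window`).  This file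
re-runs §3/§5/§6 of the route with the ONE leaf that sees the coupling — `CouplingLipschitzBy φ ℓ′ ℓ` (modulus in
`|φ c − φ c′|`) — and concludes `T4CurrencyMatching.HistLipschitzBy φ (moduli …) γ β` and the K-uniform
`T4CauchySum.InjectedRate` through `T4CurrencyMatching.injectedRate_of_runs_by` with the currency weight
`T4CurrencyMatching.CurrencyWeight φ γ w` (`currencyWeight_invSq`: w = 1 for t = g⁻²; `currencyWeight_id`: w = γ³/2;
`currencyWeight_logT`/`_log`).  The transfer/activity/admissibility/scale-shift leaves are currency-free and reused verbatim;
`couplingLipschitzBy_id_iff`: φ = id is files 1–2.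

WHAT IS PROVED (kernel, `[folklore]` bookkeeping; no `sorry`): §1 `CouplingLipschitzBy`, `couplingLipschitzBy_id_iff`;
§2 `deviation_step_by`, `weightedContent_le_by` (the same Neumann series with the source `ℓ′|φ p_j − φ q_j|`);
§3 **`histLipschitzBy_of_model`**; §4 **`ne4TripleBy_of_model`** (`ScaleShiftRate ∧ HistLipschitzBy φ ∧ FadingMemory`);
§5 **`injectedRate_of_model_by`** (window `C_Λ·w·θ/(θ − ν) ≤ (1 − θ)/2`).
-/

noncomputable section

open scoped BigOperators
open Finset

namespace Summit.QuantumFields.BalabanUV.T4Continuum.NE4TransferResolventCurrency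

open Literature.MathematicalPhysics.QuantumFieldTheory.Balaban1983to89
open Literature.MathematicalPhysics.QuantumFieldTheory.Balaban1983to89.FlowStep
open Literature.MathematicalPhysics.QuantumFieldTheory.Balaban1983to89.T4CouplingMatching
open Literature.MathematicalPhysics.QuantumFieldTheory.Balaban1983to89.T4CurrencyMatching (HistLipschitzBy CurrencyWeight)
open Literature.MathematicalPhysics.QuantumFieldTheory.Balaban1983to89.T4BetaMemorySharp (acc acc_zero acc_succ state_le)
open Literature.MathematicalPhysics.QuantumFieldTheory.Balaban1983to89.T4OutputRate (Window mem_window)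
open Summit.QuantumFields.BalabanUV.T4Continuum.NE4TransferModel
open Summit.QuantumFields.BalabanUV.T4Continuum.NE4TransferModel.StepTransferModel
open Summit.QuantumFields.BalabanUV.T4Continuum.NE4TransferResolvent

variable {𝔅 𝔸 : Type*} [NormedAddCommGroup 𝔅] [NormedSpace ℝ 𝔅] [NormedAddCommGroup 𝔸] [NormedSpace ℝ 𝔸]

/-! ## §1 The coupling leaf in the currency φ -/

/-- LEAF (one step; qualitative in print, G-t4-U2-2): LIPSCHITZ DEPENDENCE ON THE CURRENT COUPLING MEASURED IN THE CURRENCY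
`φ` — at fixed admissible old data the stored new bracket moves by `≤ ℓ′|φ c − φ c′|` and β¹ by `≤ ℓ|φ c − φ c′|`.  For
`φ = invSq` (t = g⁻²) this is the currency of row NE9's coupling two-point bounds (`NE9LastCouplingBridge` §5).  Hypothesis
shape; asserted by nobody. [folklore] -/
def CouplingLipschitzBy (M : StepTransferModel 𝔅 𝔸) (φ : ℝ → ℝ) (ℓ' ℓ E₀ γ : ℝ) : Prop :=
  ∀ k (c c' : ℝ) (E : Fin k → 𝔅), 0 < c → c ≤ γ → 0 < c' → c' ≤ γ → (∀ j, ‖E j‖ ≤ E₀) →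
    ‖M.N k c (M.W k c E) - M.N k c' (M.W k c' E)‖ ≤ ℓ' * |φ c - φ c'| ∧
    |M.r k c (M.W k c E) - M.r k c' (M.W k c' E)| ≤ ℓ * |φ c - φ c'|

/-- The g-currency leaf of file 1 is the case `φ = id`. [folklore] -/
theorem couplingLipschitzBy_id_iff (M : StepTransferModel 𝔅 𝔸) (ℓ' ℓ E₀ γ : ℝ) :
    CouplingLipschitzBy M id ℓ' ℓ E₀ γ ↔ M.CouplingLipschitz ℓ' ℓ E₀ γ := Iff.rfl

/-! ## §2 The one-step deviation inequality and its Neumann series, source in the currency φ -/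

section Deviation

variable {M : StepTransferModel 𝔅 𝔸}

/-- ONE-STEP DEVIATION INEQUALITY, currency φ: `d_j ≤ ℓ′|φ p_j − φ q_j| + C_F·C_W·Σ_{i<j} ω^{j−1−i}d_i`. [folklore] -/
theorem deviation_step_by {φ : ℝ → ℝ} {γ C_W ω C_F C_r ℓ' ℓ E₀ : ℝ} (hRep : M.Represents γ) (hT : M.TransferBound C_W ω γ)
    (hA : M.ActivityLipschitz C_F C_r E₀ γ) (hC : CouplingLipschitzBy M φ ℓ' ℓ E₀ γ) (hAdm : M.Admissible E₀ γ)
    (hCF : 0 ≤ C_F) {p q : ℕ → ℝ} (hp : p ∈ Window γ) (hq : q ∈ Window γ) (j : ℕ) :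
    ‖M.B j (prefixOf p j) - M.B j (prefixOf q j)‖ ≤
      ℓ' * |φ (p j) - φ (q j)| + C_F * C_W * acc ω (fun i => ‖M.B i (prefixOf p i) - M.B i (prefixOf q i)‖) j := by
  have hEp : ∀ i : Fin j, ‖M.older j p i‖ ≤ E₀ := fun i => hAdm i p hp
  have hEq : ∀ i : Fin j, ‖M.older j q i‖ ≤ E₀ := fun i => hAdm i q hq
  rw [hRep j p hp, hRep j q hq]
  have h1 := (hA j (p j) (M.older j p) (M.older j q) (hp j).1 (hp j).2 hEp hEq).1
  have h2 := (hC j (p j) (q j) (M.older j q) (hp j).1 (hp j).2 (hq j).1 (hq j).2 hEq).1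
  have hlin : M.W j (p j) (M.older j p) - M.W j (p j) (M.older j q) = M.W j (p j) (M.older j p - M.older j q) := by
    rw [map_sub]
  have h3' : ‖M.W j (p j) (M.older j p) - M.W j (p j) (M.older j q)‖ ≤
      C_W * acc ω (fun i => ‖M.B i (prefixOf p i) - M.B i (prefixOf q i)‖) j := by
    rw [hlin]
    refine (hT j (p j) (M.older j p - M.older j q) (hp j).1 (hp j).2).trans (le_of_eq ?_)
    rw [← sum_fin_weight_eq_acc]
    simp [StepTransferModel.older]
  calc ‖M.N j (p j) (M.act j p) - M.N j (q j) (M.act j q)‖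
      ≤ ‖M.N j (p j) (M.act j p) - M.N j (p j) (M.W j (p j) (M.older j q))‖
        + ‖M.N j (p j) (M.W j (p j) (M.older j q)) - M.N j (q j) (M.act j q)‖ := norm_sub_le_norm_sub_add_norm_sub _ _ _
    _ ≤ C_F * ‖M.W j (p j) (M.older j p) - M.W j (p j) (M.older j q)‖ + ℓ' * |φ (p j) - φ (q j)| := add_le_add h1 h2
    _ ≤ C_F * (C_W * acc ω (fun i => ‖M.B i (prefixOf p i) - M.B i (prefixOf q i)‖) j) + ℓ' * |φ (p j) - φ (q j)| :=
        add_le_add (mul_le_mul_of_nonneg_left h3' hCF) le_rfl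
    _ = _ := by ring

/-- NEUMANN SERIES, currency φ: `Σ_{i<j} ω^{j−1−i}d_i ≤ ℓ′·Σ_{i<j} ν^{j−1−i}|φ p_i − φ q_i|`, `ν = ω + C_F·C_W`
(`T4BetaMemorySharp.state_le`). [folklore] -/
theorem weightedContent_le_by {φ : ℝ → ℝ} {γ C_W ω C_F C_r ℓ' ℓ E₀ : ℝ} (hRep : M.Represents γ)
    (hT : M.TransferBound C_W ω γ) (hA : M.ActivityLipschitz C_F C_r E₀ γ) (hC : CouplingLipschitzBy M φ ℓ' ℓ E₀ γ)
    (hAdm : M.Admissible E₀ γ) (hω : 0 ≤ ω) (hCF : 0 ≤ C_F) (hCW : 0 ≤ C_W) {p q : ℕ → ℝ} (hp : p ∈ Window γ)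
    (hq : q ∈ Window γ) (j : ℕ) :
    acc ω (fun i => ‖M.B i (prefixOf p i) - M.B i (prefixOf q i)‖) j ≤
      acc (ω + C_F * C_W) (fun i => ℓ' * |φ (p i) - φ (q i)|) j :=
  state_le (s := fun n => acc ω (fun i => ‖M.B i (prefixOf p i) - M.B i (prefixOf q i)‖) n)
    (b := fun i => ‖M.B i (prefixOf p i) - M.B i (prefixOf q i)‖) hω (mul_nonneg hCF hCW)
    (by simp [acc_zero]) (fun n => (acc_succ ω _ n).le)
    (fun n => deviation_step_by hRep hT hA hC hAdm hCF hp hq n) j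

end Deviation

/-! ## §3 Row (b) in the currency φ -/

/-- **`T4CurrencyMatching.HistLipschitzBy φ` FROM THE ONE-STEP LEAVES (kernel)**: the history moduli of the full β in the
currency `φ` are `moduli ℓ ℓ′ C_r C_W ν` (file 1), `ν = ω + C_F·C_W` — fading at the rate `ν` by `fadingMemory_moduli`
(currency-free).  Hypotheses: the two identifications, `TransferBound`, `ActivityLipschitz`, `CouplingLipschitzBy φ`,
`Admissible`, signs. [folklore] -/
theorem histLipschitzBy_of_model {β : HBeta} (S : B12Beta.OneLoopSplit β) (M : StepTransferModel 𝔅 𝔸) (φ : ℝ → ℝ)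
    {γ C_W ω C_F C_r ℓ' ℓ E₀ : ℝ} (hRep : M.Represents γ) (hRead : M.ReadsRemainder S γ)
    (hT : M.TransferBound C_W ω γ) (hA : M.ActivityLipschitz C_F C_r E₀ γ) (hC : CouplingLipschitzBy M φ ℓ' ℓ E₀ γ)
    (hAdm : M.Admissible E₀ γ) (hω : 0 ≤ ω) (hCF : 0 ≤ C_F) (hCW : 0 ≤ C_W) (hCr : 0 ≤ C_r) :
    HistLipschitzBy φ (moduli ℓ ℓ' C_r C_W (ω + C_F * C_W)) γ β := by
  intro k p q hp hq
  set gp := extend p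
  set gq := extend q
  have hwp : gp ∈ Window γ := extend_mem_window hp
  have hwq : gq ∈ Window γ := extend_mem_window hq
  have ep : p = prefixOf gp k := (prefixOf_extend p).symm
  have eq' : q = prefixOf gq k := (prefixOf_extend q).symm
  have hEp : ∀ i : Fin k, ‖M.older k gp i‖ ≤ E₀ := fun i => hAdm i gp hwp
  have hEq : ∀ i : Fin k, ‖M.older k gq i‖ ≤ E₀ := fun i => hAdm i gq hwq
  have esplit : β k p - β k q = S.β1 k p - S.β1 k q := by rw [S.split k p, S.split k q]; ring
  rw [esplit, ep, eq', hRead k gp hwp, hRead k gq hwq]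
  have h1 := (hA k (gp k) (M.older k gp) (M.older k gq) (hwp k).1 (hwp k).2 hEp hEq).2
  have h2 := (hC k (gp k) (gq k) (M.older k gq) (hwp k).1 (hwp k).2 (hwq k).1 (hwq k).2 hEq).2
  have hlin : M.W k (gp k) (M.older k gp) - M.W k (gp k) (M.older k gq) = M.W k (gp k) (M.older k gp - M.older k gq) := by
    rw [map_sub]
  have h3 : ‖M.W k (gp k) (M.older k gp) - M.W k (gp k) (M.older k gq)‖ ≤
      C_W * acc ω (fun i => ‖M.B i (prefixOf gp i) - M.B i (prefixOf gq i)‖) k := by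
    rw [hlin]
    refine (hT k (gp k) _ (hwp k).1 (hwp k).2).trans (le_of_eq ?_)
    rw [← sum_fin_weight_eq_acc]
    simp [StepTransferModel.older]
  have h4 := weightedContent_le_by hRep hT hA hC hAdm hω hCF hCW hwp hwq k
  have hmain : |M.r k (gp k) (M.act k gp) - M.r k (gq k) (M.act k gq)| ≤
      ℓ * |φ (gp k) - φ (gq k)| + C_r * C_W * acc (ω + C_F * C_W) (fun i => ℓ' * |φ (gp i) - φ (gq i)|) k := by
    calc |M.r k (gp k) (M.act k gp) - M.r k (gq k) (M.act k gq)|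
        ≤ |M.r k (gp k) (M.act k gp) - M.r k (gp k) (M.W k (gp k) (M.older k gq))|
          + |M.r k (gp k) (M.W k (gp k) (M.older k gq)) - M.r k (gq k) (M.act k gq)| := abs_sub_le _ _ _
      _ ≤ C_r * ‖M.W k (gp k) (M.older k gp) - M.W k (gp k) (M.older k gq)‖ + ℓ * |φ (gp k) - φ (gq k)| :=
          add_le_add h1 h2
      _ ≤ C_r * (C_W * acc (ω + C_F * C_W) (fun i => ℓ' * |φ (gp i) - φ (gq i)|) k) + ℓ * |φ (gp k) - φ (gq k)| :=
          add_le_add (mul_le_mul_of_nonneg_left (h3.trans (mul_le_mul_of_nonneg_left h4 hCW)) hCr) le_rfl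
      _ = _ := by ring
  have hsum : ∑ i : Fin (k + 1), moduli ℓ ℓ' C_r C_W (ω + C_F * C_W) k i * |φ (prefixOf gp k i) - φ (prefixOf gq k i)|
      = ℓ * |φ (gp k) - φ (gq k)| + C_r * C_W * acc (ω + C_F * C_W) (fun i => ℓ' * |φ (gp i) - φ (gq i)|) k := by
    have := sum_moduli_eq ℓ ℓ' C_r C_W (ω + C_F * C_W) k (fun i => |φ (gp i) - φ (gq i)|)
    simpa [prefixOf] using this
  rw [hsum]
  exact hmain

/-! ## §4 Node U2's triple in the currency φ -/

/-- **NODE U2's TRIPLE, currency φ (kernel)**: with (AF-0r) `hconv` and the g-free leaves of file 2's row (a),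
`ScaleShiftRate (2c₀ + shiftConst …) θ γ β ∧ HistLipschitzBy φ (moduli …) γ β ∧ FadingMemory (ℓ + C_r·C_W·ℓ′/ν) ν (moduli …)`
— the input list of `T4CurrencyMatching.injectedRate_of_runs_by` and of the row's t-faces (`NE4ReadOutSocketGaussian*`).
[folklore] -/
theorem ne4TripleBy_of_model {β : HBeta} (S : B12Beta.OneLoopSplit β) (M : StepTransferModel 𝔅 𝔸) (φ : ℝ → ℝ)
    {γ C_W ω C_F C_r ℓ' ℓ E₀ b b_r ρ θ binf c₀ : ℝ} (hRep : M.Represents γ) (hRead : M.ReadsRemainder S γ)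
    (hT : M.TransferBound C_W ω γ) (hA : M.ActivityLipschitz C_F C_r E₀ γ) (hC : CouplingLipschitzBy M φ ℓ' ℓ E₀ γ)
    (hAdm : M.Admissible E₀ γ) (hS : M.StepScaleShift b b_r ρ E₀ γ)
    (hCF : 0 ≤ C_F) (hCr : 0 ≤ C_r) (hCW : 0 ≤ C_W) (hE₀ : 0 ≤ E₀) (hℓ : 0 ≤ ℓ) (hℓ' : 0 ≤ ℓ')
    (hω : 0 < ω) (hb : 0 ≤ b) (hbr : 0 ≤ b_r) (hρ : 0 ≤ ρ) (hρθ : ρ ≤ θ) (hνθ : ω + C_F * C_W < θ) (hθ1 : θ ≤ 1)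
    (hc₀ : 0 ≤ c₀) (hconv : ∀ k, |S.β0 k - binf| ≤ c₀ * θ ^ k) :
    ScaleShiftRate (2 * c₀ + shiftConst b b_r C_F C_r C_W E₀ ω θ) θ γ β ∧
      HistLipschitzBy φ (moduli ℓ ℓ' C_r C_W (ω + C_F * C_W)) γ β ∧
      T4CouplingMatching.FadingMemory (ℓ + C_r * C_W * ℓ' / (ω + C_F * C_W)) (ω + C_F * C_W)
        (moduli ℓ ℓ' C_r C_W (ω + C_F * C_W)) := by
  have hθ0 : 0 ≤ θ := hρ.trans hρθ
  have hν : 0 < ω + C_F * C_W := by nlinarith [mul_nonneg hCF hCW]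
  refine ⟨?_, ?_, ?_⟩
  · exact scaleShiftRate_of_split S hθ0 hθ1 hc₀ hconv
      (remainderShiftRate_of_model S M hRep hRead hT hA hAdm hS hCF hCr hCW hE₀ hω.le hb hbr hρ hρθ hνθ)
  · exact histLipschitzBy_of_model S M φ hRep hRead hT hA hC hAdm hω.le hCF hCW hCr
  · exact fadingMemory_moduli hℓ hℓ' hCr hCW hν

/-! ## §5 The K-uniform injected rate in the currency φ -/

/-- **END TO END, currency φ (kernel)**: one-step leaves (coupling modulus in the currency φ) + (AF-0r) + IR-pinned windowed
runs of (0.20) + the currency weight `CurrencyWeight φ γ w` + node U2's window `C_Λ·w·θ/(θ − ν) ≤ (1 − θ)/2` ⟹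
`T4CauchySum.InjectedRate (2(2c₀ + c₁)/(1 − θ)) 0 θ (fun K j ↦ disc (g K) (g (K+1)) j)`, constant INDEPENDENT OF K, via
`T4CurrencyMatching.injectedRate_of_runs_by`.  For `φ = invSq` take `w = 1` (`currencyWeight_invSq`); for `φ = id`,
`w = γ³/2` recovers file 2's `injectedRate_of_model`.  HONEST: conditional on every displayed binder; NOT infinite volume,
NOT a mass gap, NOT Clay. [folklore] -/
theorem injectedRate_of_model_by {β : HBeta} (S : B12Beta.OneLoopSplit β) (M : StepTransferModel 𝔅 𝔸) (φ : ℝ → ℝ)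
    {γ C_W ω C_F C_r ℓ' ℓ E₀ b b_r ρ θ binf c₀ w : ℝ} (g : ℕ → ℕ → ℝ) (gIR : ℝ)
    (hRep : M.Represents γ) (hRead : M.ReadsRemainder S γ)
    (hT : M.TransferBound C_W ω γ) (hA : M.ActivityLipschitz C_F C_r E₀ γ) (hC : CouplingLipschitzBy M φ ℓ' ℓ E₀ γ)
    (hAdm : M.Admissible E₀ γ) (hS : M.StepScaleShift b b_r ρ E₀ γ)
    (hCF : 0 ≤ C_F) (hCr : 0 ≤ C_r) (hCW : 0 ≤ C_W) (hE₀ : 0 ≤ E₀) (hℓ : 0 ≤ ℓ) (hℓ' : 0 ≤ ℓ')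
    (hω : 0 < ω) (hb : 0 ≤ b) (hbr : 0 ≤ b_r) (hρ : 0 ≤ ρ) (hρθ : ρ ≤ θ) (hνθ : ω + C_F * C_W < θ) (hθ1 : θ < 1)
    (hc₀ : 0 ≤ c₀) (hconv : ∀ k, |S.β0 k - binf| ≤ c₀ * θ ^ k) (hw : 0 ≤ w) (hφ : CurrencyWeight φ γ w)
    (hrun : ∀ K, RGEqH K β (g K)) (hbox : ∀ K i, i ≤ K → 0 < g K i ∧ g K i ≤ γ) (hpin : ∀ K, g K K = gIR)
    (hsmall : (ℓ + C_r * C_W * ℓ' / (ω + C_F * C_W)) * w * (θ / (θ - (ω + C_F * C_W))) ≤ (1 - θ) / 2) :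
    T4CauchySum.InjectedRate (2 * (2 * c₀ + shiftConst b b_r C_F C_r C_W E₀ ω θ) / (1 - θ)) 0 θ
      (fun K j => disc (g K) (g (K + 1)) j) := by
  obtain ⟨hSh, hL, hΛ⟩ := ne4TripleBy_of_model S M φ hRep hRead hT hA hC hAdm hS hCF hCr hCW hE₀ hℓ hℓ' hω hb hbr hρ
    hρθ hνθ hθ1.le hc₀ hconv
  have hθ0 : 0 < θ := by nlinarith [mul_nonneg hCF hCW]
  have hν0 : 0 ≤ ω + C_F * C_W := by nlinarith [mul_nonneg hCF hCW]
  have hc : 0 ≤ 2 * c₀ + shiftConst b b_r C_F C_r C_W E₀ ω θ := by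
    have := shiftConst_nonneg hb hbr hCF hCr hCW hE₀ hνθ
    linarith
  have hCΛ : 0 ≤ ℓ + C_r * C_W * ℓ' / (ω + C_F * C_W) := by positivity
  exact T4CurrencyMatching.injectedRate_of_runs_by g gIR hθ0 hθ1 hθ0.le le_rfl hν0 hνθ hc hCΛ hw hrun hbox hpin
    hSh hL hΛ hφ hsmall

end Summit.QuantumFields.BalabanUV.T4Continuum.NE4TransferResolventCurrency
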